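import Mathlib
import HarnessLib
import Summits.ValiantsHypothesis.ValiantsHypothesis.Theses.MonotoneRestoration
import Literature.Computability.AlgebraicComplexity.ArithCircuit
import Literature.Computability.AlgebraicComplexity.ArithCircuitProofs
import Literature.Computability.AlgebraicComplexity.MonotoneStructure
import Literature.Computability.AlgebraicComplexity.PermanentIrreducible
import Literature.ModelTheory.FiniteModelTheory.CkEquiv
import Summits.ValiantsHypothesis.ValiantsHypothesis.Theorems.MonotoneRestorationMonotoneRestorationQPCosetCount
import Summits.ValiantsHypothesis.ValiantsHypothesis.Theorems.MonotoneRestorationMonotoneRestorationQPSymmetricLB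
import Summits.ValiantsHypothesis.ValiantsHypothesis.Theorems.MonotoneRestorationMonotoneRestorationQPSupportSymmetrisation
import Summits.ValiantsHypothesis.ValiantsHypothesis.Theorems.MonotoneRestorationMonotoneRestorationQPSparseRegime
import Summits.ValiantsHypothesis.ValiantsHypothesis.Theorems.MonotoneRestorationMonotoneRestorationQPBeta
import Literature.Computability.AlgebraicComplexity.SymmetricArithCircuit
import Literature.Computability.AlgebraicComplexity.DawarWilsenach2025Proofs
import Literature.GroupTheory.PermutationGroups.SmallIndexSubgroups
import Summits.ValiantsHypothesis.ValiantsHypothesis.Theorems.MonotoneRestorationQP.Negative.LoadBearing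
import Summits.ValiantsHypothesis.ValiantsHypothesis.Theorems.MonotoneRestorationMonotoneRestorationQPPermSupportCount

/-! TTRL-lite variant V19877 of stmt-ValiantsHypothesis-15886 -/

-- `ValiantsHypothesis.ValiantsHypothesis`: the D-0017 layout repeats the problem name in the path.
set_option linter.dupNamespace false

namespace Summit.ValiantsHypothesis.ValiantsHypothesis.Theorems

open Summit.ValiantsHypothesis.ValiantsHypothesis.Theses.MonotoneRestoration
open Literature.Computability.AlgebraicComplexity

/-- TTRL-lite variant V19877 (move `generalise`, boundary probe) of `stub_mulGate_children_extend`
is FALSE: a SINGLE shift `μ` cannot in general serve two DIFFERENT pairs of factors of a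
three-fold product `p * q * r`, even when `supp (p * q * r) + μ₀ ⊆ supp f`.  Witness (`n := 1`,
coefficients in `ℝ≥0`, `x := X (0,0)`): `p = q = x`, `r = x ^ 2`, `f = x ^ 4 = p * q * r`
(so the hypothesis holds with `μ₀ = 0`).  The pair `(p, q)` forces `1 + 1 + μ (0,0) = 4`, i.e.
`μ (0,0) = 2`, while the pair `(p, r)` forces `1 + 2 + μ (0,0) = 4`, i.e. `μ (0,0) = 1`.
Hence the pair shift of the stub's part (2) genuinely depends on the pair (the per-pair `∃ μ`
form is the true one). [folklore] -/
theorem stub_mulGate_children_extend_var19877_false :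
    ¬ (∀ (p q r f : MvPolynomial (Fin 1 × Fin 1) NNReal), p * q * r ≠ 0 →
        (∃ μ : (Fin 1 × Fin 1) →₀ ℕ, ∀ m ∈ (p * q * r).support, m + μ ∈ f.support) →
        ∃ μ : (Fin 1 × Fin 1) →₀ ℕ,
          (∀ m ∈ p.support, ∀ m' ∈ q.support, m + m' + μ ∈ f.support) ∧
          (∀ m ∈ p.support, ∀ m' ∈ r.support, m + m' + μ ∈ f.support)) := by
  intro h
  -- the witness variable `x := X (0,0)` and its powers
  have hx4 : (MvPolynomial.X ((0 : Fin 1), (0 : Fin 1)) : MvPolynomial (Fin 1 × Fin 1) NNReal) *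
      MvPolynomial.X (0, 0) * MvPolynomial.X (0, 0) ^ 2 = MvPolynomial.X (0, 0) ^ 4 := by
    ring
  have hne : (MvPolynomial.X ((0 : Fin 1), (0 : Fin 1)) : MvPolynomial (Fin 1 × Fin 1) NNReal) *
      MvPolynomial.X (0, 0) * MvPolynomial.X (0, 0) ^ 2 ≠ 0 := by
    rw [hx4]
    exact pow_ne_zero _ (MvPolynomial.X_ne_zero _)
  have hext : ∃ μ : (Fin 1 × Fin 1) →₀ ℕ,
      ∀ m ∈ ((MvPolynomial.X ((0 : Fin 1), (0 : Fin 1)) : MvPolynomial (Fin 1 × Fin 1) NNReal) *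
        MvPolynomial.X (0, 0) * MvPolynomial.X (0, 0) ^ 2).support,
        m + μ ∈ ((MvPolynomial.X ((0 : Fin 1), (0 : Fin 1)) :
          MvPolynomial (Fin 1 × Fin 1) NNReal) ^ 4).support := by
    refine ⟨0, fun m hm => ?_⟩
    rw [hx4] at hm
    rwa [add_zero]
  obtain ⟨μ, h1, h2⟩ := h (MvPolynomial.X (0, 0)) (MvPolynomial.X (0, 0))
    (MvPolynomial.X (0, 0) ^ 2) (MvPolynomial.X (0, 0) ^ 4) hne hext
  -- pair `(p, q)`: `single 1 + single 1 + μ = single 4`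
  have e1 := h1 (Finsupp.single (0, 0) 1) (by rw [MvPolynomial.support_X, Finset.mem_singleton])
    (Finsupp.single (0, 0) 1) (by rw [MvPolynomial.support_X, Finset.mem_singleton])
  -- pair `(p, r)`: `single 1 + single 2 + μ = single 4`
  have e2 := h2 (Finsupp.single (0, 0) 1) (by rw [MvPolynomial.support_X, Finset.mem_singleton])
    (Finsupp.single (0, 0) 2) (by rw [MvPolynomial.support_X_pow, Finset.mem_singleton])
  rw [MvPolynomial.support_X_pow, Finset.mem_singleton] at e1 e2
  have f1 := DFunLike.congr_fun e1 ((0 : Fin 1), (0 : Fin 1))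
  have f2 := DFunLike.congr_fun e2 ((0 : Fin 1), (0 : Fin 1))
  simp only [Finsupp.add_apply, Finsupp.single_eq_same] at f1 f2
  omega

end Summit.ValiantsHypothesis.ValiantsHypothesis.Theorems
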